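import Summits.KontsevichZagierPeriods.KontsevichZagierPeriods.Theorems.GammaHodgeSector.Negative.LoadBearing

/-!
# `GammaHodgeSector` (stmt-KontsevichZagierPeriods-3742) — negative side II: arithmetic of the
Hodge-type test

Landed copy of §3 of `Cruxes/GammaHodgeSector/Disproof.lean`: comparing the units `u = 1` and
`u = 2D − 1 ≡ −1 (mod D)` in the Koblitz–Ogus test gives the WEIGHT BALANCE
`N + I = N' + I' + 2k`, `I = #{j | x_j + y_j ∈ ℤ}` (`hodge_weight_balance`), whence: parity,
`k ≤ N`, equal dimensions when no sum is integral, the degenerate corner `N = 0` forces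
`N' = k = 0` and is TRUE outright (`gammaHodgeSector_dim_zero`), `N = 1, N' = 0` is the
reflection–translation sector `k = 1 ∧ x₀ + y₀ ∈ ℤ`, `N = N' = 1` is the linear sector `k = 0`.
-/

noncomputable section

open MeasureTheory Set
open scoped BigOperators

namespace Summit.KontsevichZagierPeriods.GammaHodgeSectorNegative

open Literature.NumberTheory.Transcendental
open Literature.NumberTheory.Transcendental.KZ
open Literature.ModelTheory.ExponentialFields (IsSemialgebraic isSemialgebraic_univ)
open Summit.KontsevichZagierPeriods.KontsevichZagierPeriods.Theses.TerasomaMultiplication (GammaHodgeSector)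

/-! ## §3 Arithmetic of the Hodge-type test: the weight balance `N + I = N' + I' + 2k` -/

/-- The number of indices with an INTEGER sum `x_j + y_j` (there `Γ(x_j + y_j)` is rational and
the pair contributes `{u x_j} + {u y_j} = 1` to the test for every unit `u`). [folklore] -/
def intSums {N : ℕ} (x y : Fin N → ℚ) : ℕ :=
  (Finset.univ.filter fun j => Int.fract (x j + y j) = 0).card

/-- `intSums ≤ N`. [folklore] -/
theorem intSums_le {N : ℕ} (x y : Fin N → ℚ) : intSums x y ≤ N := by
  unfold intSums
  exact (Finset.card_filter_le _ _).trans (by simp)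

/-- A common multiple of all denominators of the data (product of `den x_j · den y_j` and
`den x'_l · den y'_l`). [folklore] -/
def commonDen {N N' : ℕ} (x y : Fin N → ℚ) (x' y' : Fin N' → ℚ) : ℕ :=
  (∏ j, (x j).den * (y j).den) * ∏ l, (x' l).den * (y' l).den

/-- `commonDen` is positive. [folklore] -/
theorem commonDen_pos {N N' : ℕ} (x y : Fin N → ℚ) (x' y' : Fin N' → ℚ) :
    0 < commonDen x y x' y' :=
  Nat.mul_pos (Finset.prod_pos fun j _ => Nat.mul_pos (x j).den_pos (y j).den_pos)
    (Finset.prod_pos fun l _ => Nat.mul_pos (x' l).den_pos (y' l).den_pos)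

/-- `den x_j · den y_j ∣ commonDen`. [folklore] -/
theorem den_mul_den_dvd_commonDen {N N' : ℕ} (x y : Fin N → ℚ) (x' y' : Fin N' → ℚ) (j : Fin N) :
    (x j).den * (y j).den ∣ commonDen x y x' y' :=
  (Finset.dvd_prod_of_mem (fun j => (x j).den * (y j).den) (Finset.mem_univ j)).trans
    (dvd_mul_right _ _)

/-- `den x'_l · den y'_l ∣ commonDen`. [folklore] -/
theorem den_mul_den_dvd_commonDen' {N N' : ℕ} (x y : Fin N → ℚ) (x' y' : Fin N' → ℚ) (l : Fin N') :
    (x' l).den * (y' l).den ∣ commonDen x y x' y' :=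
  (Finset.dvd_prod_of_mem (fun l => (x' l).den * (y' l).den) (Finset.mem_univ l)).trans
    (dvd_mul_left _ _)

/-- `2D − 1` is coprime to every divisor of `D` (Bezout: `−(2D−1) + 2(D/m)·m = 1`). [folklore] -/
theorem coprime_two_mul_sub_one {D m : ℕ} (hD : 0 < D) (hm : m ∣ D) : Nat.Coprime (2 * D - 1) m := by
  rw [← Nat.isCoprime_iff_coprime]
  refine ⟨-1, 2 * ((D / m : ℕ) : ℤ), ?_⟩
  have h1 : ((2 * D - 1 : ℕ) : ℤ) = 2 * (D : ℤ) - 1 := by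
    have : 1 ≤ 2 * D := by omega
    push_cast [Nat.cast_sub this]
    ring
  have h2 : ((D / m : ℕ) : ℤ) * (m : ℤ) = D := by exact_mod_cast Nat.div_mul_cancel hm
  rw [h1]
  linear_combination 2 * h2

/-- Units `u ≡ −1 (mod D)`: `{(2D−1) q} = {−q}` whenever `den q ∣ D`. [folklore] -/
theorem fract_two_mul_sub_one_mul {D : ℕ} (hD : 0 < D) {q : ℚ} (hq : q.den ∣ D) :
    Int.fract (((2 * D - 1 : ℕ) : ℚ) * q) = Int.fract (-q) := by
  obtain ⟨e, he⟩ := hq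
  have hDq : (D : ℚ) * q = (e : ℚ) * (q.num : ℚ) := by
    have hnum : q * q.den = q.num := Rat.mul_den_eq_num q
    rw [he]
    push_cast
    linear_combination (e : ℚ) * hnum
  have hcast : ((2 * D - 1 : ℕ) : ℚ) = 2 * (D : ℚ) - 1 := by
    have : 1 ≤ 2 * D := by omega
    push_cast [Nat.cast_sub this]
    ring
  have : ((2 * D - 1 : ℕ) : ℚ) * q = ((2 * ((e : ℤ) * q.num) : ℤ) : ℚ) + (-q) := by
    rw [hcast]
    push_cast
    linear_combination (2 : ℚ) * hDq
  rw [this, Int.fract_intCast_add]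

/-- `{q} + {−q}` is `0` for integral `q` and `1` otherwise. [folklore] -/
theorem fract_add_fract_neg (q : ℚ) :
    Int.fract q + Int.fract (-q) = if Int.fract q = 0 then 0 else 1 := by
  split_ifs with h
  · rw [h, Int.fract_neg_eq_zero.mpr h, add_zero]
  · rw [Int.fract_neg h]; ring

/-- **The two test sums at `u = 1` and `u ≡ −1` add up to `N + I`.** For admissible data and `D`
a common multiple of the `den x_j · den y_j`:
`hodgeSum x y 1 + hodgeSum x y (2D−1) = N + #{j | x_j + y_j ∈ ℤ}`. [folklore] -/
theorem hodgeSum_one_add_hodgeSum_neg {N : ℕ} {x y : Fin N → ℚ} (hx : Admissible x y) {D : ℕ}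
    (hD : 0 < D) (hden : ∀ j, (x j).den * (y j).den ∣ D) :
    hodgeSum x y 1 + hodgeSum x y (2 * D - 1) = (N : ℚ) + intSums x y := by
  unfold hodgeSum intSums
  rw [← Finset.sum_add_distrib]
  have hterm : ∀ j, (Int.fract (((1 : ℕ) : ℚ) * x j) + Int.fract (((1 : ℕ) : ℚ) * y j) -
        Int.fract (((1 : ℕ) : ℚ) * (x j + y j))) +
      (Int.fract (((2 * D - 1 : ℕ) : ℚ) * x j) + Int.fract (((2 * D - 1 : ℕ) : ℚ) * y j) -
        Int.fract (((2 * D - 1 : ℕ) : ℚ) * (x j + y j))) =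
      1 + (if Int.fract (x j + y j) = 0 then 1 else 0) := by
    intro j
    obtain ⟨-, -, hxj, hyj⟩ := hx j
    have hdx : (x j).den ∣ D := (dvd_mul_right _ _).trans (hden j)
    have hdy : (y j).den ∣ D := (dvd_mul_left _ _).trans (hden j)
    have hdxy : (x j + y j).den ∣ D := (Rat.add_den_dvd (x j) (y j)).trans (hden j)
    simp only [Nat.cast_one, one_mul]
    rw [fract_two_mul_sub_one_mul hD hdx, fract_two_mul_sub_one_mul hD hdy,
      fract_two_mul_sub_one_mul hD hdxy, Int.fract_neg hxj, Int.fract_neg hyj]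
    have h := fract_add_fract_neg (x j + y j)
    split_ifs at h ⊢ with h0
    · linear_combination (-1 : ℚ) * h
    · linear_combination (-1 : ℚ) * h
  rw [Finset.sum_congr rfl fun j _ => hterm j, Finset.sum_add_distrib, Finset.sum_boole]
  simp

/-- **Weight balance.** The Hodge-type test forces `N + I = N' + I' + 2k`, where `I`, `I'`
count the integer sums (compare the units `u = 1` and `u = 2D − 1 ≡ −1 (mod D)`: their test sums
add up to `N + I` resp. `N' + I'`). In Deligne's language: the total mass `Σ n(b)` of the
Γ-monomial is `2c` (Koblitz–Ogus). [cite: KoblitzOgus1979, p. 343] -/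
theorem hodge_weight_balance {N N' k : ℕ} {x y : Fin N → ℚ} {x' y' : Fin N' → ℚ}
    (hx : Admissible x y) (hx' : Admissible x' y') (hH : HodgeCondition N N' k x y x' y') :
    N + intSums x y = N' + intSums x' y' + 2 * k := by
  set D := commonDen x y x' y' with hDdef
  have hD : 0 < D := commonDen_pos x y x' y'
  have h1 := hH 1 one_pos (fun j => ⟨Nat.coprime_one_left _, Nat.coprime_one_left _⟩)
    (fun l => ⟨Nat.coprime_one_left _, Nat.coprime_one_left _⟩)
  have hu := hH (2 * D - 1) (by omega)
    (fun j => ⟨coprime_two_mul_sub_one hD ((dvd_mul_right _ _).trans (den_mul_den_dvd_commonDen x y x' y' j)),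
      coprime_two_mul_sub_one hD ((dvd_mul_left _ _).trans (den_mul_den_dvd_commonDen x y x' y' j))⟩)
    (fun l => ⟨coprime_two_mul_sub_one hD ((dvd_mul_right _ _).trans (den_mul_den_dvd_commonDen' x y x' y' l)),
      coprime_two_mul_sub_one hD ((dvd_mul_left _ _).trans (den_mul_den_dvd_commonDen' x y x' y' l))⟩)
  have hs := hodgeSum_one_add_hodgeSum_neg hx hD (den_mul_den_dvd_commonDen x y x' y')
  have hs' := hodgeSum_one_add_hodgeSum_neg hx' hD (den_mul_den_dvd_commonDen' x y x' y')
  have key : ((N + intSums x y : ℕ) : ℚ) = ((N' + intSums x' y' + 2 * k : ℕ) : ℚ) := by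
    push_cast
    linear_combination h1 + hu - hs + hs'
  exact_mod_cast key

/-- Parity: `N + I ≡ N' + I' (mod 2)`. [folklore] -/
theorem hodge_parity {N N' k : ℕ} {x y : Fin N → ℚ} {x' y' : Fin N' → ℚ}
    (hx : Admissible x y) (hx' : Admissible x' y') (hH : HodgeCondition N N' k x y x' y') :
    (N + intSums x y) % 2 = (N' + intSums x' y') % 2 := by
  have := hodge_weight_balance hx hx' hH
  omega

/-- With no integer sums on either side the two representations have the SAME dimension:
`dim r = N = 2k + N' = dim r'`. [folklore] -/
theorem dim_eq_of_no_intSums {N N' k : ℕ} {x y : Fin N → ℚ} {x' y' : Fin N' → ℚ}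
    (hx : Admissible x y) (hx' : Admissible x' y') (hH : HodgeCondition N N' k x y x' y')
    (h0 : intSums x y = 0) (h0' : intSums x' y' = 0) : N = 2 * k + N' := by
  have := hodge_weight_balance hx hx' hH
  omega

/-- `k ≤ N`: at most `N` powers of `π` (`I ≤ N`). [folklore] -/
theorem k_le {N N' k : ℕ} {x y : Fin N → ℚ} {x' y' : Fin N' → ℚ}
    (hx : Admissible x y) (hx' : Admissible x' y') (hH : HodgeCondition N N' k x y x' y') :
    k ≤ N := by
  have := hodge_weight_balance hx hx' hH
  have := intSums_le x y
  omega

/-- **Degenerate corner `N = 0`.** The test then forces `N' = 0` and `k = 0`. [folklore] -/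
theorem eq_zero_of_N_eq_zero {N' k : ℕ} {x y : Fin 0 → ℚ} {x' y' : Fin N' → ℚ}
    (hx' : Admissible x' y') (hH : HodgeCondition 0 N' k x y x' y') : N' = 0 ∧ k = 0 := by
  have h := hodge_weight_balance (fun j => j.elim0) hx' hH
  have h0 : intSums x y = 0 := by simp [intSums]
  omega

/-- The value of a dimension-0 representation with full domain is its integrand at the point
(`vol ℝ⁰ = 1`). [cite: KontsevichZagier2001, §1.1] -/
theorem value_dim_zero (ρ : IntegralRep 0) (hd : ρ.domain = univ) :
    ρ.value = ρ.integrand (fun i => i.elim0) := by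
  unfold IntegralRep.value
  rw [hd, Measure.restrict_univ, volume_pi, Measure.pi_of_empty _ (fun i => i.elim0), integral_dirac]

/-- Two dimension-0 representations with full domain and the same integrand are equal, hence
equivalent. [folklore] -/
theorem equivalent_of_eq_dim_zero (ρ ρ' : IntegralRep 0) (hd : ρ.domain = univ) (hd' : ρ'.domain = univ)
    (hi : ρ.integrand = ρ'.integrand) : Equivalent ρ ρ' := by
  obtain ⟨d, f, _, _, _⟩ := ρ
  obtain ⟨d', f', _, _, _⟩ := ρ'
  simp only at hd hd' hi
  subst hd hd' hi
  exact Equivalent.refl _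

/-- **The dimension-0 instances are TRUE outright** (not vacuous, not false): for `N = 0` the
test forces `N' = k = 0`, value equality forces `c = 1`, and then `r = r' = [pt, 1]`. So the
degenerate corner is harmless. [folklore] -/
theorem gammaHodgeSector_dim_zero {N' k : ℕ} (x y : Fin 0 → ℚ) (x' y' : Fin N' → ℚ) (c : ℝ)
    (hx' : Admissible x' y') (hH : HodgeCondition 0 N' k x y x' y')
    (r : IntegralRep 0) (r' : IntegralRep (2 * k + N')) (hr : IsCubeBetaRep x y r)
    (hr' : IsBallCubeRep k x' y' c r') (hv : r.value = r'.value) : Equivalent r r' := by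
  obtain ⟨rfl, rfl⟩ := eq_zero_of_N_eq_zero hx' hH
  change IntegralRep 0 at r'
  have hdr : r.domain = univ := by rw [hr.1]; ext; simp
  have hdr' : r'.domain = univ := by rw [hr'.1]; ext; simp
  have hint : r.integrand = r'.integrand := by
    funext z
    have hz : z = fun i => i.elim0 := Subsingleton.elim _ _
    rw [hz, ← value_dim_zero r hdr, ← value_dim_zero r' hdr', hv]
  exact equivalent_of_eq_dim_zero r r' hdr hdr' hint

/-- **Reflection–translation sector `N = 1`, `N' = 0`.** The test forces `k = 1` and
`x₀ + y₀ ∈ ℤ`; these instances read `[(0,1), t^{x−1}(1−t)^{m−x−1}] ~ [unit disc, c]`,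
`B(x, m − x) = c·π` (Euler reflection + translation; `m = 1`, `x = 1/2` is KZ's own §1.1 example
`∫ dx/√(x(1−x))` versus the area of the disc). [folklore] -/
theorem reflection_sector_of_N_one {k : ℕ} {x y : Fin 1 → ℚ} {x' y' : Fin 0 → ℚ}
    (hx : Admissible x y) (hH : HodgeCondition 1 0 k x y x' y') :
    k = 1 ∧ Int.fract (x 0 + y 0) = 0 := by
  have h := hodge_weight_balance hx (fun l => l.elim0) hH
  have hI := intSums_le x y
  have h0' : intSums x' y' = 0 := by simp [intSums]
  have hI1 : intSums x y = 1 := by omega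
  refine ⟨by omega, ?_⟩
  have hsub : (Finset.univ.filter fun j : Fin 1 => Int.fract (x j + y j) = 0) = Finset.univ :=
    Finset.eq_of_subset_of_card_le (Finset.filter_subset _ _) (by simpa [intSums] using hI1.ge)
  have hmem : (0 : Fin 1) ∈ Finset.univ.filter fun j : Fin 1 => Int.fract (x j + y j) = 0 := by
    rw [hsub]; exact Finset.mem_univ _
  exact (Finset.mem_filter.mp hmem).2

/-- **Linear sector `N = N' = 1`.** The test forces `k = 0` and "`x₀+y₀ ∈ ℤ ↔ x'₀+y'₀ ∈ ℤ`"
(e.g. the duplication pairs `B(1/2,s) = 2^{1−2s} B(s,s)` and `DasGapTwelve`). [folklore] -/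
theorem linear_sector_of_N_one_N'_one {k : ℕ} {x y x' y' : Fin 1 → ℚ}
    (hx : Admissible x y) (hx' : Admissible x' y') (hH : HodgeCondition 1 1 k x y x' y') :
    k = 0 ∧ intSums x y = intSums x' y' := by
  have h := hodge_weight_balance hx hx' hH
  have hI := intSums_le x y
  have hI' := intSums_le x' y'
  omega



end Summit.KontsevichZagierPeriods.GammaHodgeSectorNegative
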